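import Summits.HodgeConjecture.HodgeConjecture.Theorems.Ring2AbelianAllAndreProductPencilsRows
import Summits.HodgeConjecture.HodgeConjecture.Theorems.Ring2AbelianAllWeilFloor
import Summits.HodgeConjecture.HodgeConjecture.Theorems.Ring2AbelianAllAndreWeilSixfoldsMiddleDegree
import HarnessLib

/-!
# Ring 2 · sub-cell AbelianAll (ALL ABELIAN VARIETIES), André axis, part XXXII-e — THE FIRST MIDDLE CELL `(6, 3)`: the unrefereed
# input of part XXXII-c's "`B_min` starts at `(6, 3)`" rows (Markman 2025 for Weil-type abelian FOURFOLDS) is replaced by the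
# refereed facts [Koike 2004, Schoen 1998, Markman 2023] + the cell's typed obligations + the single residual NODE `WeilFourfoldResidual`
# of the Weil floor; and the `m = 3` instance of `(L)^mid` on `E`-power-pointed pencils is EXACTLY the input of the Weil-sixfold habitat:
# `(W_E)₃ ∧ (L)^mid_{≥3} ⟹ W₆`, no `HC_CM`, no Verdier

HONEST FRAMING (page 1, verbatim): **research route, not a corollary; conditional on HC_CM plus one named
minimal statement.** Cell line: research route conditional on HC_CM; not a corollary; Q11.4-sentence-2 already
refuted in dim ≥ 3. Nothing in this file proves a case of the Hodge conjecture for an abelian variety. `HC_CM`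
(`Theses.RankFourFaces.CMAbelianHodge`) and `HC_AV` (`Theses.PadicSemiregularLift.HodgeAbelianVarieties`) are BINDERS (inside
`↔`); the refereed NAMED-FACT binders are `h01` (Moonen–Zarhin 1999 Thms. 0.1–0.2), `hK` (Koike 2004), `hS` (Schoen 1998 §10),
`hM23` (Markman 2023 Thm. 1.3), `hGT` (Verdier 1976), `h₂₁` (André Lemme 6.3.1); the cell's typed obligations `hL`
(`LandherrSplitCriterion`), `hE` (`PolarizedWeilDiscriminantExists`) and the NODES `WeilFourfoldResidual` (Weil floor, ab-weil-1),
`CMPowerAnchoredCompactWeilPencilsAt 3` (`(W_E)₃`, part IX) are HYPOTHESES wherever used, never asserted; the reduction item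
`CMToAbelian` (stmt-16267) is NOT closed; `B_min` of record (N104) untouched; NO node born (file-local notations `LiftMid[k]`,
`TransportMid[k]` as in parts XXXII-b/c); nothing claimed minimal; 0 `def`, 0 `sorry`, axioms standard.

## What this part does

* §1 **`cmAnchoredTransport_iff_transportMid_three_of_refereed_and_residual`** — `(4) ⟺ (4)^mid_{≥3}` modulo [MZ99, Koike 2004,
  Schoen 1998, Markman 2023; `LandherrSplitCriterion`, `PolarizedWeilDiscriminantExists`; `WeilFourfoldResidual`] (NO Verdier, NO unrefereed
  fact: the Weil floor's `markmanFourfolds_of_refereed_and_residual` feeds part XXXII-c's Markman binder); the deliverable-shape rows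
  `HC_AV_iff_HC_CM_and_transportMid_three_of_refereed_and_residual` (+ Lemme 6.3.1) and the lift forms `…liftMid_three…` (+ Verdier).
  READING: the only unrefereed content left in "the André-axis `B_min` starts at the cell `(6, 3)`" is the cell's own residual node
  `WeilFourfoldResidual` — Weil classes on the fourfold components `(2, d, δ)`, `d ∉ {1, 3}`, `δ` non-split.
* §2 **`weilSixfolds_of_cmPowerWeilPencilsAt_of_liftMid_three`** — `(W_E)₃ ∧ (L)^mid_{≥3} ⟹ W₆` and the non-split twin, FACT-FREE
  (part XXVIII-e's `weilSixfolds_of_cmPowerWeilPencilsAt_of_lift_three` needs `(L)_t(3)` at the `E`-power points of compact pencils of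
  abelian sixfolds only, and `E`-power points are CM points, `cmPowerLocus_subset_cmLocus`): the `m = 3` instance of the first middle
  cell, read on the `E`-power-pointed pencils, IS the input of the Weil-sixfold habitat; node form `weilSixfolds_of_cmPowerWeilPencilsAt_of_cmFibreAlgebraicLift`
  (`(W_E)₃ ∧ (L) ⟹ W₆`, no `HC_CM`, no Verdier).

EDGE LABELS: §1 K[MZ99, Koike04, Schoen98, Markman23, hL, hE, W₄ʳᵉˢ] (+[6.3.1] / +[Verdier] as displayed); §2 K (fact-free, habitat
node as hypothesis). What is NOT claimed: any case of HC; that `(6, 3)` alone suffices; anything minimal.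

References: MoonenZarhin1999LowDim (Thms. 0.1–0.2, (2.7)); Koike2004WeilHodge (Rem. 2.1); Schoen1998HodgeWeilAddendum (§10);
Markman2023GeneralizedKummers (Thm. 1.3); Markman2025SurveySecant (Thm. 1.2, statement only); vanGeemen1994HodgeAV (Thm. 4.3, 5.12);
Andre1996Motifs (Lemme 6.3.1 p. 31, Lemme 6.3.3 p. 33); Verdier1976 (Cor. (5.1)); Milne1999 (§2 p. 54).
-/

noncomputable section

set_option linter.dupNamespace false

namespace Summit.HodgeConjecture.HodgeConjecture.Ring2.AbelianAll

open CategoryTheory AlgebraicGeometry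
open Literature.AlgebraicGeometry Literature.AlgebraicGeometry.Motives
open Literature.AlgebraicGeometry.HodgeTheory
open Literature.AlgebraicGeometry.Deligne1982 (cmLocus)
open Literature.AlgebraicGeometry.Andre1996 (andre1996_cmAnchoredPencil)
open Summit.HodgeConjecture.HodgeConjecture
open Summit.HodgeConjecture.HodgeConjecture.Theses
open Summit.HodgeConjecture.HodgeConjecture.Ring2.Hypotheses
open Summit.HodgeConjecture.HodgeConjecture.WeilTypeLadder (NonsplitSixfolds nonsplitSixfolds_of_weilSixfolds)

variable {𝒳 S : SchemeOver ℂ}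

/-! ## §0 The middle-degree forms (file-local notations, as in parts XXXII-b/c) -/

/-- `(L)^mid_{≥k}` (file-local notation, as in part XXXII-b). -/
local notation3 (prettyPrint := false) "LiftMid[" k "]" =>
  ∀ ⦃m : ℕ⦄ ⦃𝒳 S : SchemeOver ℂ⦄ (f : 𝒳 ⟶ S), IsCompactAbelianPencil f (2 * m) → k ≤ m →
    ∀ t ∈ cmLocus f (2 * m),
      (algebraicClasses (fiberOver f t) m).comap (complexBetti.map (fiberι f t) (2 * m)).hom ≤
        algebraicClasses 𝒳 m ⊔ LinearMap.ker (complexBetti.map (fiberι f t) (2 * m)).hom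

/-- `(4)^mid_{≥k}` (file-local notation, as in part XXXII-b). -/
local notation3 (prettyPrint := false) "TransportMid[" k "]" =>
  ∀ ⦃m : ℕ⦄ ⦃𝒳 S : SchemeOver ℂ⦄ (f : 𝒳 ⟶ S), IsCompactAbelianPencil f (2 * m) → k ≤ m →
    ∀ (W : complexBetti 𝒳 (2 * m)), ∀ t ∈ cmLocus f (2 * m),
      complexBetti.map (fiberι f t) (2 * m) W ∈ algebraicClasses (fiberOver f t) m →
      ∀ s : ComplexPoints S, complexBetti.map (fiberι f s) (2 * m) W ∈ algebraicClasses (fiberOver f s) m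

/-! ## §1 The cell `(4, 2)` from refereed facts and the Weil-floor residual -/

/-- **`(4) ⟺ (4)^mid_{≥3}` modulo [Moonen–Zarhin 1999; Koike 2004, Schoen 1998, Markman 2023 (refereed); the typed obligations
`LandherrSplitCriterion`, `PolarizedWeilDiscriminantExists`; the residual NODE `WeilFourfoldResidual`]** — part XXXII-c's
`cmAnchoredTransport_iff_transportMid_three_of_moonenZarhin_of_markman` with Markman's unrefereed fourfold statement DERIVED from the
Weil floor (`markmanFourfolds_of_refereed_and_residual`). NO Verdier, NO `HC_CM`. [cite: MoonenZarhin1999LowDim, Thms. 0.1–0.2]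
[cite: Koike2004WeilHodge, Rem. 2.1] [cite: Schoen1998HodgeWeilAddendum, §10] [cite: Markman2023GeneralizedKummers, Thm. 1.3] -/
theorem cmAnchoredTransport_iff_transportMid_three_of_refereed_and_residual
    (h01 : MoonenZarhin1999_codimTwoHodgeClasses_abelianFourfold) (hK : Koike2004_weilClasses_algebraic_hyperbolicSixfold_one)
    (hS : Schoen1998_weilClasses_algebraic_hyperbolicSixfold_three) (hL : LandherrSplitCriterion)
    (hM23 : Markman2023_weilClasses_algebraic_discOneWeilFourfold) (hE : PolarizedWeilDiscriminantExists) (hR : WeilFourfoldResidual) :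
    CMAnchoredTransport ↔ TransportMid[3] :=
  cmAnchoredTransport_iff_transportMid_three_of_moonenZarhin_of_markman h01
    (markmanFourfolds_of_refereed_and_residual hK hS hL hM23 hE hR)

/-- **`HC_AV ⟺ HC_CM ∧ (4)^mid_{≥3}` modulo [Lemme 6.3.1, MZ99, Koike04, Schoen98, Markman23, hL, hE, `WeilFourfoldResidual`]** — the cell's
deliverable with `B_min` read on compact pencils of abelian varieties of even relative dimension `2m ≥ 6`, MIDDLE degree, transport form;
the only unrefereed input is the residual NODE of the Weil floor. research route, not a corollary; conditional on HC_CM plus one named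
minimal statement. [cite: Andre1996Motifs, Lemme 6.3.1 (p. 31)] [cite: MoonenZarhin1999LowDim, Thms. 0.1–0.2] [cite: Schoen1998HodgeWeilAddendum, §10] -/
theorem HC_AV_iff_HC_CM_and_transportMid_three_of_refereed_and_residual (h₂₁ : andre1996_cmAnchoredPencil)
    (h01 : MoonenZarhin1999_codimTwoHodgeClasses_abelianFourfold) (hK : Koike2004_weilClasses_algebraic_hyperbolicSixfold_one)
    (hS : Schoen1998_weilClasses_algebraic_hyperbolicSixfold_three) (hL : LandherrSplitCriterion)
    (hM23 : Markman2023_weilClasses_algebraic_discOneWeilFourfold) (hE : PolarizedWeilDiscriminantExists) (hR : WeilFourfoldResidual) :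
    PadicSemiregularLift.HodgeAbelianVarieties ↔ RankFourFaces.CMAbelianHodge ∧ TransportMid[3] :=
  HC_AV_iff_HC_CM_and_transportMid_three_of_moonenZarhin_of_markman h₂₁ h01
    (markmanFourfolds_of_refereed_and_residual hK hS hL hM23 hE hR)

/-- **`(L) ⟺ (L)^mid_{≥3}` modulo [Verdier; MZ99, Koike04, Schoen98, Markman23, hL, hE, `WeilFourfoldResidual`]** (lift form).
[cite: Verdier1976, Cor. (5.1)] [cite: MoonenZarhin1999LowDim, Thms. 0.1–0.2] [cite: Schoen1998HodgeWeilAddendum, §10] -/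
theorem cmFibreAlgebraicLift_iff_liftMid_three_of_verdier_of_refereed_and_residual (hGT : Verdier1976_genericLocalTriviality)
    (h01 : MoonenZarhin1999_codimTwoHodgeClasses_abelianFourfold) (hK : Koike2004_weilClasses_algebraic_hyperbolicSixfold_one)
    (hS : Schoen1998_weilClasses_algebraic_hyperbolicSixfold_three) (hL : LandherrSplitCriterion)
    (hM23 : Markman2023_weilClasses_algebraic_discOneWeilFourfold) (hE : PolarizedWeilDiscriminantExists) (hR : WeilFourfoldResidual) :
    CMFibreAlgebraicLift ↔ LiftMid[3] :=
  cmFibreAlgebraicLift_iff_liftMid_three_of_verdier hGT h01 (markmanFourfolds_of_refereed_and_residual hK hS hL hM23 hE hR)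

/-- **`HC_AV ⟺ HC_CM ∧ (L)^mid_{≥3}` modulo [Lemme 6.3.1, Verdier; MZ99, Koike04, Schoen98, Markman23, hL, hE, `WeilFourfoldResidual`].**
research route, not a corollary; conditional on HC_CM plus one named minimal statement. [cite: Andre1996Motifs, Lemme 6.3.1 (p. 31)]
[cite: Verdier1976, Cor. (5.1)] [cite: MoonenZarhin1999LowDim, Thms. 0.1–0.2] -/
theorem HC_AV_iff_HC_CM_and_liftMid_three_of_verdier_of_refereed_and_residual (h₂₁ : andre1996_cmAnchoredPencil)
    (hGT : Verdier1976_genericLocalTriviality) (h01 : MoonenZarhin1999_codimTwoHodgeClasses_abelianFourfold)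
    (hK : Koike2004_weilClasses_algebraic_hyperbolicSixfold_one) (hS : Schoen1998_weilClasses_algebraic_hyperbolicSixfold_three)
    (hL : LandherrSplitCriterion) (hM23 : Markman2023_weilClasses_algebraic_discOneWeilFourfold) (hE : PolarizedWeilDiscriminantExists)
    (hR : WeilFourfoldResidual) :
    PadicSemiregularLift.HodgeAbelianVarieties ↔ RankFourFaces.CMAbelianHodge ∧ LiftMid[3] :=
  HC_AV_iff_HC_CM_and_liftMid_three_of_verdier h₂₁ hGT h01 (markmanFourfolds_of_refereed_and_residual hK hS hL hM23 hE hR)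

/-! ## §2 The `m = 3` instance on `E`-power-pointed pencils is the input of the Weil-sixfold habitat -/

/-- **`(W_E)₃ ∧ (L)^mid_{≥3} ⟹ W₆` — FACT-FREE, no `HC_CM`, no Verdier.** Part XXVIII-e needs `(L)_t(3)` only at the `E`-power
points of compact pencils of abelian SIXFOLDS — CM points (`cmPowerLocus_subset_cmLocus`) in the first middle cell `(6, 3)`.
[cite: vanGeemen1994HodgeAV, Thm. 4.3 and 5.12] [cite: Andre1996Motifs, Lemme 6.3.3 (p. 33)] [cite: Milne1999, §2 p. 54] -/
theorem weilSixfolds_of_cmPowerWeilPencilsAt_of_liftMid_three (hW : CMPowerAnchoredCompactWeilPencilsAt 3) (h : LiftMid[3]) :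
    Theses.SevenfoldWeilCensus.WeilSixfolds :=
  weilSixfolds_of_cmPowerWeilPencilsAt_of_lift_three hW fun _ _ f hf t ht ↦
    h f (show IsCompactAbelianPencil f (2 * 3) from hf) le_rfl t (cmPowerLocus_subset_cmLocus f 6 ht)

/-- The NON-SPLIT twin: `(W_E)₃ ∧ (L)^mid_{≥3} ⟹` the non-split Weil sixfolds. [cite: Andre1996Motifs, Lemme 6.3.3 (p. 33)] -/
theorem nonsplitSixfolds_of_cmPowerWeilPencilsAt_of_liftMid_three (hW : CMPowerAnchoredCompactWeilPencilsAt 3) (h : LiftMid[3]) :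
    NonsplitSixfolds :=
  nonsplitSixfolds_of_weilSixfolds (weilSixfolds_of_cmPowerWeilPencilsAt_of_liftMid_three hW h)

/-- **Node form: `(W_E)₃ ∧ (L) ⟹ W₆`** — FACT-FREE (through `(L) ⟺ (L)^mid_{≥2} ⟹ (L)^mid_{≥3}`). [cite: vanGeemen1994HodgeAV, Thm. 4.3 and 5.12]
[cite: Andre1996Motifs, Lemme 6.3.3 (p. 33)] -/
theorem weilSixfolds_of_cmPowerWeilPencilsAt_of_cmFibreAlgebraicLift (hW : CMPowerAnchoredCompactWeilPencilsAt 3)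
    (hL : CMFibreAlgebraicLift) : Theses.SevenfoldWeilCensus.WeilSixfolds :=
  weilSixfolds_of_cmPowerWeilPencilsAt_of_liftMid_three hW fun _ _ _ f hf hm t ht ↦
    (cmFibreAlgebraicLift_iff_liftMid.1 hL) f hf (le_trans (by norm_num) hm) t ht

/-- Node form, non-split: `(W_E)₃ ∧ (L) ⟹` the non-split Weil sixfolds. [cite: Andre1996Motifs, Lemme 6.3.3 (p. 33)] -/
theorem nonsplitSixfolds_of_cmPowerWeilPencilsAt_of_cmFibreAlgebraicLift (hW : CMPowerAnchoredCompactWeilPencilsAt 3)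
    (hL : CMFibreAlgebraicLift) : NonsplitSixfolds :=
  nonsplitSixfolds_of_weilSixfolds (weilSixfolds_of_cmPowerWeilPencilsAt_of_cmFibreAlgebraicLift hW hL)

end Summit.HodgeConjecture.HodgeConjecture.Ring2.AbelianAll

end
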